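import Summits.BirchSwinnertonDyer.BirchSwinnertonDyer.Theorems.TwistFamilyManinDescentIsogenyTableFamiliesReduction
import Summits.BirchSwinnertonDyer.BirchSwinnertonDyer.Theorems.TwistFamilyManinDescentConductorSupportBound
import Literature.NumberTheory.EllipticCurves.ManinConstantConductorLt500000
import Literature.NumberTheory.EllipticCurves.BarriosEtAl2025.QuadraticTwistAtTwoConductorProofs
import Literature.NumberTheory.EllipticCurves.QuadraticTwistMinimalModelProofs
import Literature.NumberTheory.EllipticCurves.RootNumberSmulProofs
import Literature.NumberTheory.EllipticCurves.QuadraticTwistIntegralModel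
import Literature.NumberTheory.EllipticCurves.SzpiroLocalDataProofs
import HarnessLib

/-!
# Route `TwistFamilyManinDescent`, crux `IsogenyTableFamiliesManinOne` (stmt-BirchSwinnertonDyer-25137): the FAMILY
# ENGINE with the EXACT DYADIC EXPONENT (base semistable at `2`: `f₂(E₀ ⊗ d₀) ≤ 6`, so `2⁶·∏ q² < 5·10⁵` suffices)

THEOREMS ONLY, no route file imported (`--supports` 25137).
* `conductorExponent_two_quadraticTwist_le_six` — for `W/ℚ` elliptic with `f₂(W) ≤ 1` (good or multiplicative at `2`)
  and `d` square-free: `f₂(W ⊗ d) ≤ 6`. By residues of `d mod 4`: `≡ 3 ⟹ 4`, `≡ 2 ⟹ 6` (Barrios et al. 2025 Thm 5.1,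
  tree theorem `BarriosEtAl2025.conductorExponent_quadraticTwist_two_of_le_one_holds`), `≡ 1 ⟹` the twist is the
  integral `twistModel` with an odd parameter, unramified at `2` (`conductorExponent_twistModel`), so `f₂` is
  unchanged; `≡ 0` is excluded by square-freeness.
* `conductorNorm_dvd_of_good_outside_of_two_le` — the support bound with a prescribed dyadic exponent `e`.
* `classAbsManinConstantEqOne_of_j_eq_of_disc_support_two` — the engine of `…IsogenyTableFamilyEngine` with `2⁸`
  replaced by `2⁶` under the extra hypothesis `f₂(E₀) ≤ 1`. Covers the `17`-families (base `2·5²·17²`,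
  `2⁶·5²·17² = 462400`) and the `67`-family (`2⁶·67² = 287296`).
Nothing about BSD is proved; Manin's conjecture is not proved.
-/

-- D-0017: single-problem summit, so `Summit.BirchSwinnertonDyer.BirchSwinnertonDyer.…` repeats a namespace BY DESIGN.
set_option linter.dupNamespace false
set_option autoImplicit false

noncomputable section

open scoped Classical

open WeierstrassCurve IsDedekindDomain Rat.HeightOneSpectrum
  Literature.NumberTheory.EllipticCurves Literature.NumberTheory.EllipticCurves.ModularForms

namespace Summit.BirchSwinnertonDyer.BirchSwinnertonDyer.Theorems.TwistFamilyManinDescent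

/-- **`f₂(W ⊗ d) ≤ 6` for `W` semistable at `2` and `d` square-free.** [cite: BarriosEtAl2025, Thm. 5.1]
[cite: SilvermanATAEC1994, IV.10.4] -/
theorem conductorExponent_two_quadraticTwist_le_six (W : WeierstrassCurve ℚ) [W.IsElliptic]
    (v : HeightOneSpectrum ℤ) (hv : natGenerator v = 2) (hf : W.conductorExponent v ≤ 1)
    {d : ℤ} (hd : Squarefree d) : (W.quadraticTwist (d : ℚ)).conductorExponent v ≤ 6 := by
  haveI : PerfectField (IsLocalRing.ResidueField (v.adicCompletionIntegers ℚ)) := PerfectField.ofFinite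
  have hd0 : d ≠ 0 := hd.ne_zero
  have hdq : (d : ℚ) ≠ 0 := by exact_mod_cast hd0
  haveI := W.isElliptic_quadraticTwist hdq
  have key := BarriosEtAl2025.conductorExponent_quadraticTwist_two_of_le_one_holds W v hv hf d
  -- `4 ∤ d`
  have h4 : ¬ (4 : ℤ) ∣ d := fun h ↦ by
    have h22 : (2 : ℤ) * 2 ∣ d := by norm_num; exact h
    have hu := hd 2 h22
    rw [Int.isUnit_iff] at hu
    omega
  have hlt : d % 4 < 4 := Int.emod_lt_of_pos d (by norm_num)
  have hge : 0 ≤ d % 4 := Int.emod_nonneg d (by norm_num)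
  have hne0 : d % 4 ≠ 0 := fun h ↦ h4 (Int.dvd_of_emod_eq_zero h)
  have hcases : d % 4 = 1 ∨ d % 4 = 2 ∨ d % 4 = 3 := by omega
  rcases hcases with h1 | h2 | h3
  · -- unramified at `2`: the odd-parameter twist model
    set k : ℤ := d / 4 with hk
    have hkd : 4 * k + 1 = d := by have := Int.emod_add_mul_ediv d 4; omega
    have hkq : (4 * (k : ℚ) + 1) = (d : ℚ) := by exact_mod_cast hkd
    obtain ⟨C, -, hC⟩ := exists_variableChange_twistModel_eq_quadraticTwist W (k : ℚ)
    rw [hkq] at hC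
    haveI : (W.twistModel (k : ℚ)).IsElliptic := by
      refine ⟨?_⟩
      rw [twistModel_Δ, hkq]
      exact (IsUnit.mk0 _ (pow_ne_zero 6 hdq)).mul W.isUnit_Δ
    rw [← hC, conductorExponent_smul' v _ C]
    have h2d : ¬ ((natGenerator v : ℕ) : ℤ) ∣ 4 * k + 1 := by rw [hv]; push_cast; omega
    rw [conductorExponent_twistModel v W
      (by rw [show (k : ℚ) = algebraMap ℤ ℚ k from (eq_intCast _ k).symm]
          exact HeightOneSpectrum.valuation_le_one v k)
      (by rw [show (4 * (k : ℚ) + 1 : ℚ) = ((4 * k + 1 : ℤ) : ℚ) by push_cast; ring,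
            Literature.NumberTheory.EllipticCurves.Rat.valuation_intCast_eq_one_iff]
          exact h2d)]
    omega
  · rw [key.2 h2]
  · rw [key.1 h3]; norm_num

/-- **`N(V) ∣ B` from the support of the bad primes, with a prescribed dyadic exponent `e`**: as
`conductorNorm_dvd_of_good_outside` with `f₂(V) ≤ e` and `2ᵉ ∣ B` in place of `f₂ ≤ 8`, `2⁸ ∣ B`.
[cite: SilvermanATAEC1994, IV.10.4 and IV.11] [cite: SilvermanAEC2009, C.16] -/
theorem conductorNorm_dvd_of_good_outside_of_two_le (V : WeierstrassCurve ℚ) [V.IsElliptic] (S : Finset ℕ)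
    (hS5 : ∀ q ∈ S, 5 ≤ q) (hgood : ∀ (q : ℕ) (hq : q.Prime), q ≠ 2 → q ∉ S →
      (haveI := Fact.mk hq; V.HasGoodReductionAtPrime q))
    (e : ℕ) (he : ∀ v : HeightOneSpectrum ℤ, natGenerator v = 2 → V.conductorExponent v ≤ e)
    (B : ℕ) (hB0 : B ≠ 0) (hB2 : 2 ^ e ∣ B) (hBS : ∀ q ∈ S, q ^ 2 ∣ B) :
    V.conductorNorm ℤ ∣ B := by
  set N := V.conductorNorm ℤ with hN
  have hN0 : N ≠ 0 := (V.conductorNorm_pos_holds).ne'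
  refine (Nat.factorization_le_iff_dvd hN0 hB0).mp (Finsupp.le_def.mpr fun p ↦ ?_)
  by_cases hpP : p.Prime
  swap
  · rw [Nat.factorization_eq_zero_of_not_prime _ hpP]; exact Nat.zero_le _
  haveI := Fact.mk hpP
  set v : HeightOneSpectrum ℤ := (primesEquiv (R := ℤ)).symm ⟨p, hpP⟩ with hv
  have hgen : natGenerator v = p := congrArg Subtype.val ((primesEquiv (R := ℤ)).apply_symm_apply ⟨p, hpP⟩)
  have hfact : N.factorization p = V.conductorExponent v := by
    rw [← hgen]; exact V.factorization_conductorNorm_holds v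
  rw [hfact]
  refine (hpP.pow_dvd_iff_le_factorization hB0).mp ?_
  by_cases hp2 : p = 2
  · subst hp2
    exact (Nat.pow_dvd_pow 2 (he v hgen)).trans hB2
  by_cases hpS : p ∈ S
  · have h5 : 5 ≤ natGenerator v := by rw [hgen]; exact hS5 p hpS
    exact (Nat.pow_dvd_pow p (V.conductorExponent_le_two_of_five_le_natGenerator_holds v h5)).trans (hBS p hpS)
  · haveI : PerfectField (IsLocalRing.ResidueField (v.adicCompletionIntegers ℚ)) := PerfectField.ofFinite
    have hg : V.HasGoodReductionAt v :=
      (V.hasGoodReductionAtPrime_iff_hasGoodReductionAt_holds ⟨p, hpP⟩).mp (hgood p hpP hp2 hpS)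
    have h0 : V.conductorExponent v = 0 := (V.conductorExponent_eq_zero_iff_holds v).mpr hg
    rw [h0, pow_zero]
    exact one_dvd B

/-- **The family engine with the exact dyadic exponent.** As `classAbsManinConstantEqOne_of_j_eq_of_disc_support`,
with `2⁶·∏_{q∈S} q² < 5·10⁵` and the extra hypothesis `f₂(W₀) ≤ 1` (the base is good or multiplicative at `2`):
the inner twists `W₀ ⊗ d₀` (`d₀` square-free on `{2} ∪ S`) then have `f₂ ≤ 6`
(`conductorExponent_two_quadraticTwist_le_six`). [cite: BarriosEtAl2025, Thm. 5.1]
[cite: CremonaAlgorithms1997, §3.8] [cite: Stevens1989, Lemmas (5.2), (5.4)] -/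
theorem classAbsManinConstantEqOne_of_j_eq_of_disc_support_two (hnf : exists_isNewformOf)
    (hCre : cremona_abs_maninConstant_eq_one_of_level_le_500000)
    (hT : ∀ (E₀ : WeierstrassCurve ℚ) [E₀.IsElliptic] (A : ℕ),
      (∀ (q : ℕ) [Fact q.Prime], q ≠ 2 → Rank1Residual.Addv E₀ q → q ∣ A) →
      ∀ d₀ d₁ : ℤ, d₀ ≠ 0 → d₁ ≠ 0 → IsCoprime d₁ (2 * A * d₀) →
      ClassAbsManinConstantEqOne (E₀.quadraticTwist ((d₀ : ℤ) : ℚ)) →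
      ClassAbsManinConstantEqOne (E₀.quadraticTwist ((-d₀ : ℤ) : ℚ)) →
      ClassAbsManinConstantEqOne (E₀.quadraticTwist ((d₀ * d₁ : ℤ) : ℚ)))
    (W₀ : WeierstrassCurve ℤ) [(W₀.baseChange ℚ).IsElliptic]
    (h0 : (W₀.baseChange ℚ).j ≠ 0) (h1728 : (W₀.baseChange ℚ).j ≠ 1728)
    (h2 : ∀ v : HeightOneSpectrum ℤ, natGenerator v = 2 → (W₀.baseChange ℚ).conductorExponent v ≤ 1)
    (S : Finset ℕ) (hSp : ∀ q ∈ S, q.Prime) (hS5 : ∀ q ∈ S, 5 ≤ q)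
    (hΔ : ∀ q : ℕ, q.Prime → (q : ℤ) ∣ W₀.Δ → q = 2 ∨ q ∈ S)
    (hB : 2 ^ 6 * ∏ q ∈ S, q ^ 2 < 500000)
    (W : WeierstrassCurve ℚ) [W.IsElliptic] (hjW : W.j = (W₀.baseChange ℚ).j) :
    ClassAbsManinConstantEqOne W := by
  have hlt := cremona_abs_maninConstant_eq_one_of_level_lt_500000_of_le_500000 hCre
  set A : ℕ := ∏ q ∈ S, q with hAdef
  have hprime2A : ∀ q : ℕ, q.Prime → q ∣ 2 * A → q = 2 ∨ q ∈ S := by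
    intro q hq hdvd
    rcases (Nat.Prime.dvd_mul hq).mp hdvd with h | h
    · exact Or.inl ((Nat.prime_dvd_prime_iff_eq hq Nat.prime_two).mp h)
    · right
      obtain ⟨r, hr, hqr⟩ := (Prime.dvd_finsetProd_iff hq.prime _).mp h
      rwa [(Nat.prime_dvd_prime_iff_eq hq (hSp r hr)).mp hqr]
  refine classAbsManinConstantEqOne_of_j_eq_of_certificates (W₀.baseChange ℚ) h0 h1728 A (hT _ A ?_) ?_ W hjW
  · intro q _ hq2 hadd
    have hq : q.Prime := Fact.out
    by_cases hqS : q ∈ S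
    · exact Finset.dvd_prod_of_mem _ hqS
    · exfalso
      have hnd : ¬ (q : ℤ) ∣ W₀.Δ := fun h ↦ by
        rcases hΔ q hq h with h2' | hS
        · exact hq2 h2'
        · exact hqS hS
      exact hadd.1 (Literature.NumberTheory.EllipticCurves.BurungaleSkinner2023.hasGoodReductionAtPrime_baseChange_int_of_not_dvd
        W₀ hnd)
  · intro d₀ hd₀ hsq hsupp
    have hd₀q : ((d₀ : ℤ) : ℚ) ≠ 0 := by exact_mod_cast hd₀
    haveI := (W₀.baseChange ℚ).isElliptic_quadraticTwist hd₀q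
    have hB0 : 2 ^ 6 * ∏ q ∈ S, q ^ 2 ≠ 0 := by
      refine mul_ne_zero (by norm_num) (Finset.prod_ne_zero_iff.mpr fun q hq ↦ ?_)
      exact pow_ne_zero _ (hSp q hq).ne_zero
    have hdvd : ((W₀.baseChange ℚ).quadraticTwist ((d₀ : ℤ) : ℚ)).conductorNorm ℤ ∣ 2 ^ 6 * ∏ q ∈ S, q ^ 2 := by
      refine conductorNorm_dvd_of_good_outside_of_two_le _ S hS5 ?_ 6
        (fun v hv ↦ conductorExponent_two_quadraticTwist_le_six _ v hv (h2 v hv) hsq) _ hB0 (dvd_mul_right _ _)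
        fun q hq ↦ dvd_mul_of_dvd_right (Finset.dvd_prod_of_mem _ hq) _
      intro q hq hq2 hqS
      haveI := Fact.mk hq
      have hnΔ : ¬ (q : ℤ) ∣ W₀.Δ := fun h ↦ by
        rcases hΔ q hq h with h2' | hS
        · exact hq2 h2'
        · exact hqS hS
      have hnd : ¬ (q : ℤ) ∣ d₀ := fun h ↦ by
        rcases hprime2A q hq (hsupp q hq h) with h2' | hS
        · exact hq2 h2'
        · exact hqS hS
      exact hasGoodReductionAtPrime_quadraticTwist_baseChange_int_of_not_dvd W₀ hq2 hnΔ hnd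
    exact classAbsManinConstantEqOne_of_conductorNorm_lt_500000 hlt hnf _
      (lt_of_le_of_lt (Nat.le_of_dvd (Nat.pos_of_ne_zero hB0) hdvd) hB)

end Summit.BirchSwinnertonDyer.BirchSwinnertonDyer.Theorems.TwistFamilyManinDescent

end
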